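import Summits.HodgeConjecture.HodgeConjecture.Theorems.MarkmanPartnerTransportOrphanSR
import Literature.AlgebraicGeometry.HodgeTheory.SemiregularVariationalHodgeProofs

/-!
# Orphan levers, T3-sh «ORPH-SR, SHEAF FORM»: the semiregular seed as a `{0,1}`-semiregular sheaf
# (Buchweitz–Flenner 2003 Thm. 5.1)

Sub-problem `HodgeConjecture`, route MarkmanPartnerTransport, rung «ORPHAN-RM» (memo ROUTE-P1AJ §C.4 r11, targets
:267/:293 of `Sketch_P1AJ_OrphanSR_g37` r5, cell hodge-nonav). Companion of `…OrphanSR` (cycle seed, Bloch 1972 /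
Buchweitz–Flenner Thm. 5.2): here the seed is a `{0,1}`-SEMIREGULAR finite locally free SHEAF `E₀` on some fibre
`𝒳_{s₀}` of a connected smooth projective family `f : 𝒳 → B` through `X ≅ 𝒳_{t₁}` (integral smooth
quasi-projective base), GRANTED global classes `𝒲 k ∈ H^{2k}(𝒳(ℂ); ℂ)` whose fibre restrictions are rational of
type `(k,k)` everywhere and equal `ch_k(E₀)` at `s₀`, with `𝒲 2|_X ≡ κ_θ` modulo algebraic classes:

* `kappaClass_mem_algebraicClasses_of_semiregularSheaf` (T3A-sh): `κ_θ ∈ A²(X)` — the tree's packaged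
  Buchweitz–Flenner variational Hodge statement `BuchweitzFlenner2003_variationalHodge_semiregular.perry_near`
  (algebraic near `s₀`) → Baire spread `AlgebraicLocusSpread.algebraicLocusClosed` (Charles–Schnell, tree theorem)
  → transport along `e₁` (`map_mem_algebraicClasses_of_isIso`);
* `hodgeConjectureFor_of_quadraticEndomorphismField_of_semiregularSheaf` (T3-sh): HC⁴(X) for `E(X) = ℚ(θ)`
  real quadratic (`End_Hdg`-generation `a + cθ`) = T3B (`hodgeConjectureFor_of_kappaClass_generator`) ∘ T3A-sh;
  modulo {Buchweitz–Flenner Thm. 5.1 (`BuchweitzFlenner2003_variationalHodge_semiregular`), Verbitsky–Guan,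
  O'Grady 2008}.

CONDITIONAL on the EXISTENCE of such a sheaf seed (open; memo §C.4 (ii)–(iv): `dim Ext²(E₀,E₀) ≥ 2` with
`Tr(At ∘ ·)` injective on `ker Tr`, located at CM points of the Noether–Lefschetz locus of `θ`) and on the named
facts; credits nothing to the Hodge conjecture. Prover seat hodge-nonav-20241-p1 (gen 13),
`--supports stmt-HodgeConjecture-19653`.

References: R.-O. Buchweitz, H. Flenner, Compositio Math. 137 (2003) Thm. 5.1; S. Bloch, Invent. Math. 17
(1972); F. Charles, C. Schnell, arXiv:1010.4422 Thm. 1; K. O'Grady, *Pure Appl. Math. Q.* 4 (2008).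
-/

noncomputable section

set_option linter.dupNamespace false

open Module CategoryTheory MonoidalCategory AlgebraicGeometry
open Literature.AlgebraicTopology.SingularHomology Literature.Geometry.Kaehler
open Literature.AlgebraicGeometry Literature.AlgebraicGeometry.Motives Literature.AlgebraicGeometry.HodgeTheory
open Literature.AlgebraicGeometry.Hyperkaehler Literature.AlgebraicGeometry.Surfaces
open Summit.HodgeConjecture.HodgeConjecture.Theorems.NikulinTwinTransport
open Summit.HodgeConjecture.HodgeConjecture.Theorems.MarkmanPartnerTransport.BBFPositivity
open Summit.HodgeConjecture.HodgeConjecture.Theorems.MarkmanPartnerTransport.PartnerLattice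
open Summit.HodgeConjecture.HodgeConjecture.Theorems.MarkmanPartnerTransport.AlgebraicLocusSpread

namespace Summit.HodgeConjecture.HodgeConjecture.Theorems.MarkmanPartnerTransport.OrphanSR

/-- `MarkedK3Sq[X, φ, P, z]`: VERBATIM the `let MarkedK3Sq := …` binder of the route declarations of
MarkmanPartnerTransport (clauses (m1)–(m6)). Local notation only. -/
local notation3 (prettyPrint := false) "MarkedK3Sq[" X ", " φ ", " P ", " z "]" =>
  (((IsIntegralClass P ∧ ∀ Q : complexBetti X (2 * 4), IsIntegralClass Q → ∃ n : ℤ, Q = n • P) ∧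
    (∀ c : complexBetti X 2, IsIntegralClass c ↔ ∃ v : K3HilbertIndex → ℤ, φ c = fun i => (v i : ℂ)) ∧
    (∀ a : complexBetti X 2, cupPowTwo a 4 = ((3 : ℂ) * (k3HilbertForm 2 (φ a) (φ a)) ^ 2) • P) ∧
    (IsOfHodgeType 4 X 2 2 0 (LinearEquiv.symm φ z) ∧
      ∀ τ : complexBetti X 2, IsOfHodgeType 4 X 2 2 0 τ → ∃ t : ℂ, τ = t • LinearEquiv.symm φ z) ∧
    (∀ c : complexBetti X 2, IsOfHodgeType 4 X 2 1 1 c ↔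
      (k3HilbertForm 2 (φ c) z = 0 ∧ k3HilbertForm 2 (φ c) (star z) = 0)) ∧
    (k3HilbertForm 2 z z = 0 ∧ 0 < (k3HilbertForm 2 (star z) z).re)))

/-- `Cup3[c, y, w] = (c ∪ y) ∪ w ∈ H⁸` for `c ∈ H⁴`, `y, w ∈ H²`. Local notation only. -/
local notation3 (prettyPrint := false) "Cup3[" c ", " y ", " w "]" =>
  cupProduct (rfl : 2 * 3 + 2 = 2 * 4) (cupProduct (rfl : 2 * 2 + 2 = 2 * 3) c y) w

/-- `Kap[φ, g] = Σ_{ij} (G⁻¹)_{ij} · φ⁻¹eᵢ ∪ g(φ⁻¹eⱼ) ∈ H⁴(X(ℂ); ℂ)`, the kappa class of an endomorphism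
`g` of `H²(X(ℂ); ℂ)` (VERBATIM `…K3Sq2TypeHodgeGraphClassesGeneral`). Local notation only. -/
local notation3 (prettyPrint := false) "Kap[" φ ", " g "]" =>
  (∑ i : K3HilbertIndex, ∑ j : K3HilbertIndex,
    (((k3HilbertGram 2).map (Int.cast : ℤ → ℂ))⁻¹ i j) •
      cupProduct (rfl : 2 + 2 = 2 * 2) ((LinearEquiv.symm φ) (Pi.single i 1))
        (g ((LinearEquiv.symm φ) (Pi.single j 1))))

/-- `Res[f, s, k, A] = A|_{𝒳_s}`, restriction of a global class to the fibre over `s`. Local notation only. -/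
local notation3 (prettyPrint := false) "Res[" f ", " s ", " k ", " A "]" =>
  complexBetti.map (Motives.fiberι f s) k A

variable {X : SchemeOver ℂ} {φ : complexBetti X 2 ≃ₗ[ℂ] (K3HilbertIndex → ℂ)} {P : complexBetti X (2 * 4)}
  {z : K3HilbertIndex → ℂ}

/-! ### (T3A-sh / T3-sh / T3′-sh) the SHEAF form of the seed (Buchweitz–Flenner Thm 5.1, `I = {1,2}`) -/

/-- **(T3A-sh) sheaf seed.** Same conclusion as T3A from a `{0,1}`-SEMIREGULAR finite locally free sheaf
`E₀` on some fibre `𝒳_{s₀}` of a connected smooth projective family through `X` (BF Thm 5.1 in the tree's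
packaged form `BuchweitzFlenner2003_variationalHodge_semiregular.perry_near`), granted global classes
`𝒲 k ∈ H^{2k}(𝒳)` whose fibre restrictions are rational `(k,k)` everywhere and equal `ch_k(E₀)` at `s₀`
(so the WHOLE Chern character of the seed must stay Hodge along the family), with `𝒲 2|_X ≡ κ_θ` modulo
algebraic classes. `{0,1}`-semiregular = `(Tr, Tr(At ∘ ·))` injective on `Ext²(E₀,E₀)`. -/
theorem kappaClass_mem_algebraicClasses_of_semiregularSheaf
    (hBF : BuchweitzFlenner2003_variationalHodge_semiregular) (C : ChernCharacterBetti)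
    (θ : complexBetti X 2 →ₗ[ℂ] complexBetti X 2)
    (𝒳 B : SchemeOver ℂ) (f : 𝒳 ⟶ B) (s₀ t₁ : ComplexPoints B) (e₁ : X ≅ fiberOver f t₁)
    (𝒲 : ∀ k : ℕ, complexBetti 𝒳 (2 * k))
    (E₀ : (fiberOver f s₀).left.Modules) (hE₀ : IsFiniteLocallyFree E₀) (hsr : IsZeroOneSemiregular hE₀)
    (hf : IsSmoothProjectiveFamily f 4) (h𝒳 : IsQuasiProjectiveOver 𝒳) (hB : IsQuasiProjectiveOver B)
    (hBi : AlgebraicGeometry.IsIntegral B.left) (hBsm : AlgebraicGeometry.Smooth B.hom)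
    (hconn : ConnectedSpace (ComplexPoints B))
    (h𝒲 : ∀ (k : ℕ) (s : ComplexPoints B), IsRationalClass (Res[f, s, 2 * k, 𝒲 k]) ∧
      IsOfHodgeType 4 (fiberOver f s) (2 * k) k k (Res[f, s, 2 * k, 𝒲 k]))
    (h𝒲₀ : ∀ k : ℕ, Res[f, s₀, 2 * k, 𝒲 k] = C.ch (fiberOver f s₀) E₀ k)
    (hWθ : complexBetti.map e₁.hom (2 * 2) (Res[f, t₁, 2 * 2, 𝒲 2]) - Kap[φ, θ] ∈ algebraicClasses X 2) :
    Kap[φ, θ] ∈ algebraicClasses X 2 := by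
  obtain ⟨U, hU, hs₀, hUalg⟩ :=
    BuchweitzFlenner2003_variationalHodge_semiregular.perry_near hBF C f 4 hf hB hBi hBsm
      (fun k s => Res[f, s, 2 * k, 𝒲 k]) (fun k => continuous_globalSection f (2 * k) (𝒲 k))
      (fun k s => (mem_locusOfHodgeClasses_iff _).2 (h𝒲 k s)) s₀ E₀ hE₀ hsr h𝒲₀
  have halg := algebraicLocusClosed 𝒳 B f 4 2 (𝒲 2) hf h𝒳 hB hBsm hconn U hU ⟨s₀, hs₀⟩
    (fun b hb => (hUalg b hb).2) t₁
  have hX' := map_mem_algebraicClasses_of_isIso e₁.hom halg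
  have := sub_mem hX' hWθ
  rwa [sub_sub_cancel] at this

/-- **(T3-sh)** HC⁴(X) for `E(X) = ℚ(θ)` real quadratic (hgen shape `a + cθ`) from ONE semiregular SHEAF seed;
modulo {Buchweitz–Flenner Thm 5.1, Verbitsky–Guan, O'Grady}. -/
theorem hodgeConjectureFor_of_quadraticEndomorphismField_of_semiregularSheaf
    (hV : VerbitskyGuan_cohomology_K3HilbertSquareType) (hO : OGrady2008_dualBBFClass_algebraic)
    (hBF : BuchweitzFlenner2003_variationalHodge_semiregular) (C : ChernCharacterBetti)
    (hX : IsSmoothProjective 4 X) (hK : IsOfK3HilbertSquareType X) (hM : MarkedK3Sq[X, φ, P, z])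
    (θ : complexBetti X 2 →ₗ[ℂ] complexBetti X 2)
    (h1 : ∀ y, IsRationalClass y → IsRationalClass (θ y))
    (h2 : ∀ (i j : ℕ) y, IsOfHodgeType 4 X 2 i j y → IsOfHodgeType 4 X 2 i j (θ y))
    (hgen : ∀ f : complexBetti X 2 →ₗ[ℂ] complexBetti X 2, (∀ y, IsRationalClass y → IsRationalClass (f y)) →
      (∀ (i j : ℕ) y, IsOfHodgeType 4 X 2 i j y → IsOfHodgeType 4 X 2 i j (f y)) →
      (∀ e : complexBetti X 2, e ∈ algebraicClasses X 1 → f e = 0) →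
      (∀ y : complexBetti X 2, ∀ e : complexBetti X 2, e ∈ algebraicClasses X 1 →
        k3HilbertForm 2 (φ (f y)) (φ e) = 0) →
      ∃ a c : ℚ, ∀ y : complexBetti X 2,
        (∀ e : complexBetti X 2, e ∈ algebraicClasses X 1 → k3HilbertForm 2 (φ y) (φ e) = 0) →
        f y = (a : ℂ) • y + (c : ℂ) • θ y)
    (𝒳 B : SchemeOver ℂ) (f : 𝒳 ⟶ B) (s₀ t₁ : ComplexPoints B) (e₁ : X ≅ fiberOver f t₁)
    (𝒲 : ∀ k : ℕ, complexBetti 𝒳 (2 * k))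
    (E₀ : (fiberOver f s₀).left.Modules) (hE₀ : IsFiniteLocallyFree E₀) (hsr : IsZeroOneSemiregular hE₀)
    (hf : IsSmoothProjectiveFamily f 4) (h𝒳 : IsQuasiProjectiveOver 𝒳) (hBq : IsQuasiProjectiveOver B)
    (hBi : AlgebraicGeometry.IsIntegral B.left) (hBsm : AlgebraicGeometry.Smooth B.hom)
    (hconn : ConnectedSpace (ComplexPoints B))
    (h𝒲 : ∀ (k : ℕ) (s : ComplexPoints B), IsRationalClass (Res[f, s, 2 * k, 𝒲 k]) ∧
      IsOfHodgeType 4 (fiberOver f s) (2 * k) k k (Res[f, s, 2 * k, 𝒲 k]))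
    (h𝒲₀ : ∀ k : ℕ, Res[f, s₀, 2 * k, 𝒲 k] = C.ch (fiberOver f s₀) E₀ k)
    (hWθ : complexBetti.map e₁.hom (2 * 2) (Res[f, t₁, 2 * 2, 𝒲 2]) - Kap[φ, θ] ∈ algebraicClasses X 2) :
    HodgeConjectureFor 4 X :=
  hodgeConjectureFor_of_kappaClass_generator hV hO hX hK hM θ h1 h2 hgen
    (kappaClass_mem_algebraicClasses_of_semiregularSheaf hBF C θ 𝒳 B f s₀ t₁ e₁ 𝒲 E₀ hE₀ hsr hf h𝒳 hBq
      hBi hBsm hconn h𝒲 h𝒲₀ hWθ)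

/-! ### (T3′-sh) the sheaf seed road for `E(X) = ℚ(θ)` of ANY degree (appended, gen 13) -/

/-- **(T3′-sh) `ORPH-SR-ANY`, sheaf form.** HC⁴(X) for a marked smooth projective `K3^{[2]}`-type `X` carrying a
rational, type-preserving, `q`-self-adjoint `θ` with `End_Hdg`-generation by rational POLYNOMIALS in `θ` on `T(X)`
(`E(X) = ℚ(θ)` of ANY degree), GRANTED one `{0,1}`-semiregular SHEAF seed for `κ_θ` (as in T3A-sh): T3A-sh
(`κ_θ ∈ A²(X)`) + T3C (`exists_corrAction_eq_of_kappaClass`: `θ` cycle-induced) + F4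
(`hodgeConjectureFor_of_cycleInducedGenerator_of_charlesMarkman`); modulo {Buchweitz–Flenner Thm. 5.1,
Verbitsky–Guan, O'Grady 2008, Charles–Markman 2013}; CONDITIONAL on the sheaf-seed existence.
[cite: BuchweitzFlenner2003, Thm. 5.1] [cite: CharlesMarkman2013, Thm. 1.1 (§1)] [cite: Markman2024, §1.1 Thm. 1.1] -/
theorem hodgeConjectureFor_of_endomorphismField_of_semiregularSheaf
    (hV : VerbitskyGuan_cohomology_K3HilbertSquareType) (hO : OGrady2008_dualBBFClass_algebraic)
    (hB : CharlesMarkman2013_lefschetzStandard_K3HilbertType)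
    (hBF : BuchweitzFlenner2003_variationalHodge_semiregular) (C : ChernCharacterBetti)
    (hX : IsSmoothProjective 4 X) (hK : IsOfK3HilbertSquareType X) (hM : MarkedK3Sq[X, φ, P, z])
    (θ : complexBetti X 2 →ₗ[ℂ] complexBetti X 2)
    (h1 : ∀ y, IsRationalClass y → IsRationalClass (θ y))
    (h2 : ∀ (i j : ℕ) y, IsOfHodgeType 4 X 2 i j y → IsOfHodgeType 4 X 2 i j (θ y))
    (h5 : ∀ y w : complexBetti X 2, k3HilbertForm 2 (φ (θ y)) (φ w) = k3HilbertForm 2 (φ y) (φ (θ w)))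
    (hgen : ∀ f : complexBetti X 2 →ₗ[ℂ] complexBetti X 2, (∀ y, IsRationalClass y → IsRationalClass (f y)) →
      (∀ (i j : ℕ) y, IsOfHodgeType 4 X 2 i j y → IsOfHodgeType 4 X 2 i j (f y)) →
      (∀ d : complexBetti X 2, d ∈ algebraicClasses X 1 → f d = 0) →
      (∀ y : complexBetti X 2, ∀ d : complexBetti X 2, d ∈ algebraicClasses X 1 →
        k3HilbertForm 2 (φ (f y)) (φ d) = 0) →
      ∃ (n : ℕ) (a : Fin n → ℚ), ∀ y : complexBetti X 2,
        (∀ d : complexBetti X 2, d ∈ algebraicClasses X 1 → k3HilbertForm 2 (φ y) (φ d) = 0) →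
        f y = ∑ i : Fin n, ((a i : ℂ) • (θ ^ (i : ℕ)) y))
    (𝒳 B : SchemeOver ℂ) (f : 𝒳 ⟶ B) (s₀ t₁ : ComplexPoints B) (e₁ : X ≅ fiberOver f t₁)
    (𝒲 : ∀ k : ℕ, complexBetti 𝒳 (2 * k))
    (E₀ : (fiberOver f s₀).left.Modules) (hE₀ : IsFiniteLocallyFree E₀) (hsr : IsZeroOneSemiregular hE₀)
    (hf : IsSmoothProjectiveFamily f 4) (h𝒳 : IsQuasiProjectiveOver 𝒳) (hBq : IsQuasiProjectiveOver B)
    (hBi : AlgebraicGeometry.IsIntegral B.left) (hBsm : AlgebraicGeometry.Smooth B.hom)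
    (hconn : ConnectedSpace (ComplexPoints B))
    (h𝒲 : ∀ (k : ℕ) (s : ComplexPoints B), IsRationalClass (Res[f, s, 2 * k, 𝒲 k]) ∧
      IsOfHodgeType 4 (fiberOver f s) (2 * k) k k (Res[f, s, 2 * k, 𝒲 k]))
    (h𝒲₀ : ∀ k : ℕ, Res[f, s₀, 2 * k, 𝒲 k] = C.ch (fiberOver f s₀) E₀ k)
    (hWθ : complexBetti.map e₁.hom (2 * 2) (Res[f, t₁, 2 * 2, 𝒲 2]) - Kap[φ, θ] ∈ algebraicClasses X 2) :
    HodgeConjectureFor 4 X :=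
  hodgeConjectureFor_of_cycleInducedGenerator_of_charlesMarkman hV hO hB hX hK hM θ h1 h2
    (exists_corrAction_eq_of_kappaClass hV hB hX hK hM θ h5
      (kappaClass_mem_algebraicClasses_of_semiregularSheaf hBF C θ 𝒳 B f s₀ t₁ e₁ 𝒲 E₀ hE₀ hsr hf h𝒳 hBq
        hBi hBsm hconn h𝒲 h𝒲₀ hWθ))
    hgen

end Summit.HodgeConjecture.HodgeConjecture.Theorems.MarkmanPartnerTransport.OrphanSR

end
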